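import Summits.Parity.GeneralizedHardyLittlewood.Theorems.BeyondDiagonalBeatsQuarter.OffDiagDualTruncation
import Mathlib.NumberTheory.ZetaValues
import HarnessLib

/-!
# Route `PrimeLevelFamEdge`, crux K_B (stmt-Parity-20343), line `diagonal_kernel_split` rev 4, plan Ω,
# lemma **L2 `OffDiagDualTruncation`** (part 1b, generic): the lattice TAILS of the dual sum

Companion of `OffDiagDualTruncation` (order-`k` decay of `Φ̂ = fourier2 Φ`). For `uncurry Φ` smooth of compact
support, `c > 0`, `k ≥ 2`, `H ≥ 1`:

* `sum_inv_sq_int_le` (`Σ_{h ∈ S, h ≠ 0} h⁻² ≤ π²/3`), `sum_inv_pow_abs_int_le` (`Σ_{h ∈ S ⊆ {|h| > H}} |h|^{−k} ≤ 2H^{1−k}`);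
* **`sum_tail_norm_fourier2_le`**: for every finite `S ⊆ {h ∈ ℤ² : |h₁| > H}`,
  `Σ_{h ∈ S} ‖Φ̂(h₁/c, h₂/c)‖ ≤ 2 (c/2π)^k (A_k + (c²/12) B_k) H^{1−k}`, `A_k = ∫∫|∂₁^kΦ|`, `B_k = ∫∫|∂₁^k∂₂²Φ|`
  (order `k` in `ξ₁` at `h₂ = 0`, mixed order `(k,2)` at `h₂ ≠ 0`, summed over `h₂` by `π²/3` and over `|h₁| > H`
  by the tree's `sum_Ioc_inv_pow_le`); `tsum_tail_norm_fourier2_le` (the same for the series over `ℤ²`, with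
  summability `summable_tail_norm_fourier2`); the `h₂`-tail follows by `fourier2_transpose_of_contDiff`.

With `H = H_j q^{ε}` and `A_k, B_k ≤ (cost)^k·size` (L2c, the box weights of d5) this is the `q^{−(k−1)ε}` truncation
of OMEGA-BLUEPRINT §3 L2. Folklore, PROVED; theorems only. Helper; closes nothing.
«The programme SEARCHES and TYPES; no claim about Landau–Siegel zeros, Theorems 1–2 of arXiv:2211.02515 or
a repaired Margin232 until a kernel theorem says so.»
-/

noncomputable section

open Real MeasureTheory Complex Finset Set
open scoped FourierTransform Topology ContDiff

namespace Summit.Parity.GeneralizedHardyLittlewood.Theorems.BeyondDiagonalBeatsQuarter.OffDiagPoissonTwisted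

open Literature.NumberTheory.Sieve.FriedlanderIwaniecPrimes

/-! ### One-dimensional lattice sums -/

/-- `Σ_{h ∈ S, h ≠ 0} h⁻² ≤ π²/3` for every finite `S ⊆ ℤ` (`ζ(2) = π²/6` on each side). [folklore] -/
theorem sum_inv_sq_int_le (S : Finset ℤ) :
    ∑ h ∈ S, (if h = 0 then (0 : ℝ) else ((h : ℝ) ^ 2)⁻¹) ≤ π ^ 2 / 3 := by
  classical
  have hpos : ∀ h : ℤ, 0 ≤ (if h = 0 then (0 : ℝ) else ((h : ℝ) ^ 2)⁻¹) := fun h => by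
    split_ifs <;> positivity
  have hnat : HasSum (fun n : ℕ => ((n : ℝ) ^ 2)⁻¹) (π ^ 2 / 6) := by
    simpa [one_div] using hasSum_zeta_two
  have hint : HasSum (fun h : ℤ => (if h = 0 then (0 : ℝ) else ((h : ℝ) ^ 2)⁻¹))
      (π ^ 2 / 6 + π ^ 2 / 6) := by
    refine HasSum.of_nat_of_neg_add_one ?_ ?_
    · convert hnat using 1
      funext n
      rcases Nat.eq_zero_or_pos n with rfl | hn
      · simp
      · rw [if_neg (by exact_mod_cast hn.ne')]
        push_cast
        ring_nf
    · have h2 : HasSum (fun n : ℕ => (((n + 1 : ℕ) : ℝ) ^ 2)⁻¹) (π ^ 2 / 6) := by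
        rw [← hasSum_nat_add_iff' 1] at hnat
        simpa using hnat
      convert h2 using 1
      funext n
      rw [if_neg (by omega)]
      push_cast
      ring_nf
  calc ∑ h ∈ S, (if h = 0 then (0 : ℝ) else ((h : ℝ) ^ 2)⁻¹)
      ≤ π ^ 2 / 6 + π ^ 2 / 6 := sum_le_hasSum S (fun h _ => hpos h) hint
    _ = π ^ 2 / 3 := by ring

/-- One signed half of `sum_inv_pow_abs_int_le`: the part of `S` on which `σ > 0` (`σ = id` or `σ = −`).
[folklore] -/
theorem sum_inv_pow_abs_int_half_le {k H : ℕ} (hk : 2 ≤ k) (hH : 1 ≤ H) (S : Finset ℤ)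
    (hS : ∀ h ∈ S, (H : ℤ) < |h|) (σ : ℤ → ℤ) (hσ : ∀ h, |σ h| = |h|) (hinj : Function.Injective σ) :
    ∑ h ∈ S.filter (fun h => 0 < σ h), (|(h : ℝ)| ^ k)⁻¹ ≤ ((H : ℝ) ^ (k - 1))⁻¹ := by
  classical
  obtain ⟨N, hN⟩ : ∃ N : ℕ, ∀ h ∈ S, |h| ≤ N := by
    refine ⟨S.sup fun h => (|h|).toNat, fun h hh => ?_⟩
    have h1 := Finset.le_sup (f := fun h : ℤ => (|h|).toNat) hh
    have h2 : ((|h|).toNat : ℤ) = |h| := Int.toNat_of_nonneg (abs_nonneg h)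
    have h3 : (((|h|).toNat : ℕ) : ℤ) ≤ ((S.sup fun h => (|h|).toNat : ℕ) : ℤ) := by exact_mod_cast h1
    omega
  set T := S.filter (fun h => 0 < σ h) with hT
  have hinj' : Set.InjOn (fun h : ℤ => (σ h).toNat) T := by
    intro a ha b hb hab
    have ha' := (Finset.mem_filter.mp ha).2
    have hb' := (Finset.mem_filter.mp hb).2
    apply hinj
    have e := congrArg (fun n : ℕ => (n : ℤ)) hab
    simpa [Int.toNat_of_nonneg ha'.le, Int.toNat_of_nonneg hb'.le] using e
  calc ∑ h ∈ T, (|(h : ℝ)| ^ k)⁻¹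
      = ∑ n ∈ T.image (fun h => (σ h).toNat), ((n : ℝ) ^ k)⁻¹ := by
        rw [Finset.sum_image hinj']
        refine Finset.sum_congr rfl fun h hh => ?_
        have hh' : 0 < σ h := (Finset.mem_filter.mp hh).2
        have e1 : (((σ h).toNat : ℕ) : ℝ) = ((σ h : ℤ) : ℝ) := by
          exact_mod_cast Int.toNat_of_nonneg hh'.le
        have e2 : |(h : ℝ)| = ((σ h : ℤ) : ℝ) := by
          rw [← Int.cast_abs, ← hσ h, abs_of_pos hh']
        rw [e1, e2]
    _ ≤ ∑ n ∈ Finset.Ioc H N, ((n : ℝ) ^ k)⁻¹ := by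
        refine Finset.sum_le_sum_of_subset_of_nonneg (fun n hn => ?_) fun _ _ _ => by positivity
        obtain ⟨h, hh, rfl⟩ := Finset.mem_image.mp hn
        have hh1 := Finset.mem_filter.mp hh
        have hlt := hS h hh1.1
        have hle := hN h hh1.1
        rw [← hσ h, abs_of_pos hh1.2] at hlt hle
        have e : ((σ h).toNat : ℤ) = σ h := Int.toNat_of_nonneg hh1.2.le
        rw [Finset.mem_Ioc]
        constructor <;> omega
    _ ≤ ((H : ℝ) ^ (k - 1))⁻¹ := sum_Ioc_inv_pow_le hk hH N

/-- `Σ_{h ∈ S} |h|^{−k} ≤ 2·H^{1−k}` for every finite `S ⊆ {h ∈ ℤ : |h| > H}`, `k ≥ 2`, `H ≥ 1`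
(both signs, the tree's `sum_Ioc_inv_pow_le`). [folklore] -/
theorem sum_inv_pow_abs_int_le {k H : ℕ} (hk : 2 ≤ k) (hH : 1 ≤ H) (S : Finset ℤ)
    (hS : ∀ h ∈ S, (H : ℤ) < |h|) :
    ∑ h ∈ S, (|(h : ℝ)| ^ k)⁻¹ ≤ 2 * ((H : ℝ) ^ (k - 1))⁻¹ := by
  classical
  have hcover : ∑ h ∈ S, (|(h : ℝ)| ^ k)⁻¹ ≤
      ∑ h ∈ S.filter (fun h => 0 < h), (|(h : ℝ)| ^ k)⁻¹ +
        ∑ h ∈ S.filter (fun h => 0 < -h), (|(h : ℝ)| ^ k)⁻¹ := by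
    rw [← Finset.sum_filter_add_sum_filter_not S (fun h : ℤ => 0 < h)]
    refine add_le_add le_rfl
      (Finset.sum_le_sum_of_subset_of_nonneg (fun h hh => ?_) fun _ _ _ => by positivity)
    rw [Finset.mem_filter] at hh ⊢
    have h1 := hS h hh.1
    refine ⟨hh.1, ?_⟩
    rcases lt_trichotomy h 0 with hl | rfl | hg
    · omega
    · rw [abs_zero] at h1; omega
    · exact absurd hg hh.2
  have h1 := sum_inv_pow_abs_int_half_le hk hH S hS id (fun h => rfl) fun a b hab => hab
  have h2 := sum_inv_pow_abs_int_half_le hk hH S hS (fun h => -h) (fun h => abs_neg h) neg_injective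
  simp only [id] at h1
  linarith

/-! ### The `h₁`-tail of the dual lattice sum -/

section Tails

variable {Φ : ℝ → ℝ → ℂ}

/-- The partial-integration factor at a lattice point: `((2π|x/c|)^j)⁻¹ = (c/2π)^j |x|^{−j}` (`x ≠ 0`, `c > 0`).
[folklore] -/
theorem inv_pow_two_pi_abs_div {c : ℝ} (hc : 0 < c) {x : ℤ} (hx : x ≠ 0) (j : ℕ) :
    ((2 * π * |(x : ℝ) / c|) ^ j)⁻¹ = (c / (2 * π)) ^ j * (|(x : ℝ)| ^ j)⁻¹ := by
  have hx' : (x : ℝ) ≠ 0 := by exact_mod_cast hx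
  have hxa : |(x : ℝ)| ≠ 0 := abs_ne_zero.mpr hx'
  rw [abs_div, abs_of_pos hc, ← inv_pow, ← inv_pow, ← mul_pow]
  congr 1
  field_simp

/-- **The pointwise dual bound** used for the tails (`h₁ ≠ 0`, `c > 0`):
`‖Φ̂(h₁/c,h₂/c)‖ ≤ (c/2π)^k |h₁|^{−k} · (A_k if h₂ = 0, (c/2π)² B_k h₂⁻² if h₂ ≠ 0)`. [folklore] -/
theorem norm_fourier2_lattice_le_pow (hΦ : ContDiff ℝ ∞ (Function.uncurry Φ))
    (hΦc : HasCompactSupport (Function.uncurry Φ)) {c : ℝ} (hc : 0 < c) (k : ℕ) {h : ℤ × ℤ}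
    (h10 : h.1 ≠ 0) :
    ‖fourier2 Φ (h.1 / c) (h.2 / c)‖ ≤ (c / (2 * π)) ^ k * (|(h.1 : ℝ)| ^ k)⁻¹ *
      (if h.2 = 0 then ∫ t₂, ∫ t₁, ‖iteratedDeriv k (fun s => Φ s t₂) t₁‖
        else (c / (2 * π)) ^ 2 * ((h.2 : ℝ) ^ 2)⁻¹ *
          ∫ t₂, ∫ t₁, ‖iteratedDeriv k (fun s => iteratedDeriv 2 (Φ s) t₂) t₁‖) := by
  have h1r : (h.1 : ℝ) ≠ 0 := by exact_mod_cast h10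
  have hξ₁ : (h.1 : ℝ) / c ≠ 0 := div_ne_zero h1r hc.ne'
  by_cases h2 : h.2 = 0
  · rw [if_pos h2]
    have hb := norm_fourier2_le_left_pow_of_contDiff hΦ hΦc k hξ₁ ((h.2 : ℝ) / c)
    rw [inv_pow_two_pi_abs_div hc h10] at hb
    exact hb
  · rw [if_neg h2]
    have h2r : (h.2 : ℝ) ≠ 0 := by exact_mod_cast h2
    have hξ₂ : (h.2 : ℝ) / c ≠ 0 := div_ne_zero h2r hc.ne'
    have hb := norm_fourier2_le_mixed_pow_of_contDiff hΦ hΦc k hξ₁ hξ₂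
    rw [inv_pow_two_pi_abs_div hc h10, inv_pow_two_pi_abs_div hc h2, sq_abs] at hb
    refine hb.trans (le_of_eq ?_)
    ring

/-- **The `h₁`-tail of the dual lattice sum** (finite form). For `uncurry Φ` smooth of compact support, `c > 0`,
`k ≥ 2`, `H ≥ 1` and every finite `S ⊆ {h ∈ ℤ² : |h₁| > H}`:
`Σ_{h ∈ S} ‖Φ̂(h₁/c, h₂/c)‖ ≤ 2 (c/2π)^k (A_k + (c²/12) B_k) H^{1−k}`,
`A_k = ∫∫|∂₁^kΦ|`, `B_k = ∫∫|∂₁^k∂₂²Φ|`. [folklore] -/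
theorem sum_tail_norm_fourier2_le (hΦ : ContDiff ℝ ∞ (Function.uncurry Φ))
    (hΦc : HasCompactSupport (Function.uncurry Φ)) {c : ℝ} (hc : 0 < c) {k H : ℕ} (hk : 2 ≤ k)
    (hH : 1 ≤ H) (S : Finset (ℤ × ℤ)) (hS : ∀ h ∈ S, (H : ℤ) < |h.1|) :
    ∑ h ∈ S, ‖fourier2 Φ (h.1 / c) (h.2 / c)‖ ≤
      2 * (c / (2 * π)) ^ k *
        ((∫ t₂, ∫ t₁, ‖iteratedDeriv k (fun s => Φ s t₂) t₁‖) +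
          c ^ 2 / 12 * ∫ t₂, ∫ t₁, ‖iteratedDeriv k (fun s => iteratedDeriv 2 (Φ s) t₂) t₁‖) *
        ((H : ℝ) ^ (k - 1))⁻¹ := by
  classical
  set A : ℝ := ∫ t₂, ∫ t₁, ‖iteratedDeriv k (fun s => Φ s t₂) t₁‖ with hA
  set B : ℝ := ∫ t₂, ∫ t₁, ‖iteratedDeriv k (fun s => iteratedDeriv 2 (Φ s) t₂) t₁‖ with hB
  have hA0 : 0 ≤ A := integral_nonneg fun _ => integral_nonneg fun _ => norm_nonneg _
  have hB0 : 0 ≤ B := integral_nonneg fun _ => integral_nonneg fun _ => norm_nonneg _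
  -- the majorant `g(h) = (c/2π)^k |h₁|^{-k} · w(h₂)`, `w(0) = A`, `w(y) = (c/2π)² B y⁻²`
  set w : ℤ → ℝ := fun y => if y = 0 then A else (c / (2 * π)) ^ 2 * ((y : ℝ) ^ 2)⁻¹ * B with hw
  have hw0 : ∀ y, 0 ≤ w y := fun y => by rw [hw]; dsimp only; split_ifs <;> positivity
  have hwsum : ∀ T : Finset ℤ, ∑ y ∈ T, w y ≤ A + (c / (2 * π)) ^ 2 * B * (π ^ 2 / 3) := by
    intro T
    have hsplit : ∀ y, w y = (if y = 0 then A else 0) +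
        (c / (2 * π)) ^ 2 * B * (if y = 0 then (0 : ℝ) else ((y : ℝ) ^ 2)⁻¹) := by
      intro y
      rw [hw]; dsimp only
      split_ifs <;> ring
    rw [Finset.sum_congr rfl fun y _ => hsplit y, Finset.sum_add_distrib, ← Finset.mul_sum,
      Finset.sum_ite_eq' T (0 : ℤ) (fun _ => A)]
    refine add_le_add ?_ (mul_le_mul_of_nonneg_left (sum_inv_sq_int_le T) (by positivity))
    split_ifs
    · exact le_rfl
    · exact hA0
  have hS0 : ∀ h ∈ S, h.1 ≠ 0 := by
    intro h hh e
    have := hS h hh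
    rw [e, abs_zero] at this
    omega
  -- product-set domination
  set S₁ : Finset ℤ := S.image Prod.fst with hS₁
  set S₂ : Finset ℤ := S.image Prod.snd with hS₂
  have hsub : S ⊆ S₁ ×ˢ S₂ := fun h hh =>
    Finset.mem_product.mpr ⟨Finset.mem_image_of_mem _ hh, Finset.mem_image_of_mem _ hh⟩
  have hS₁' : ∀ x ∈ S₁, (H : ℤ) < |x| := by
    intro x hx
    obtain ⟨h, hh, rfl⟩ := Finset.mem_image.mp hx
    exact hS h hh
  calc ∑ h ∈ S, ‖fourier2 Φ (h.1 / c) (h.2 / c)‖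
      ≤ ∑ h ∈ S, (c / (2 * π)) ^ k * (|(h.1 : ℝ)| ^ k)⁻¹ * w h.2 := by
        refine Finset.sum_le_sum fun h hh => ?_
        refine (norm_fourier2_lattice_le_pow hΦ hΦc hc k (hS0 h hh)).trans (le_of_eq ?_)
        rw [hw]
    _ ≤ ∑ h ∈ S₁ ×ˢ S₂, (c / (2 * π)) ^ k * (|(h.1 : ℝ)| ^ k)⁻¹ * w h.2 :=
        Finset.sum_le_sum_of_subset_of_nonneg hsub fun h _ _ => mul_nonneg (by positivity) (hw0 _)
    _ = ∑ x ∈ S₁, (c / (2 * π)) ^ k * (|(x : ℝ)| ^ k)⁻¹ * ∑ y ∈ S₂, w y := by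
        rw [Finset.sum_product]
        exact Finset.sum_congr rfl fun x _ => by rw [Finset.mul_sum]
    _ ≤ ∑ x ∈ S₁, (c / (2 * π)) ^ k * (|(x : ℝ)| ^ k)⁻¹ * (A + (c / (2 * π)) ^ 2 * B * (π ^ 2 / 3)) :=
        Finset.sum_le_sum fun x _ => mul_le_mul_of_nonneg_left (hwsum S₂) (by positivity)
    _ = (c / (2 * π)) ^ k * (A + (c / (2 * π)) ^ 2 * B * (π ^ 2 / 3)) *
          ∑ x ∈ S₁, (|(x : ℝ)| ^ k)⁻¹ := by
        rw [Finset.mul_sum]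
        exact Finset.sum_congr rfl fun x _ => by ring
    _ ≤ (c / (2 * π)) ^ k * (A + (c / (2 * π)) ^ 2 * B * (π ^ 2 / 3)) *
          (2 * ((H : ℝ) ^ (k - 1))⁻¹) :=
        mul_le_mul_of_nonneg_left (sum_inv_pow_abs_int_le hk hH S₁ hS₁') (by positivity)
    _ = _ := by
        have hπ : (π : ℝ) ≠ 0 := Real.pi_ne_zero
        field_simp
        ring

/-- **The `h₁`-tail of the dual lattice sum is summable** (as the indicator series over `ℤ²`). [folklore] -/
theorem summable_tail_norm_fourier2 (hΦ : ContDiff ℝ ∞ (Function.uncurry Φ))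
    (hΦc : HasCompactSupport (Function.uncurry Φ)) {c : ℝ} (hc : 0 < c) (H : ℕ) :
    Summable (fun h : ℤ × ℤ =>
      if (H : ℤ) < |h.1| then ‖fourier2 Φ (h.1 / c) (h.2 / c)‖ else 0) := by
  refine Summable.of_norm_bounded (summable_fourier2_lattice_of_contDiff hΦ hΦc hc).norm fun h => ?_
  split_ifs
  · rw [Real.norm_of_nonneg (norm_nonneg _)]
  · rw [norm_zero]; exact norm_nonneg _

/-- **The `h₁`-tail of the dual lattice sum** (series form): for `uncurry Φ` smooth of compact support, `c > 0`,
`k ≥ 2`, `H ≥ 1`: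
`Σ_{h ∈ ℤ², |h₁| > H} ‖Φ̂(h₁/c, h₂/c)‖ ≤ 2 (c/2π)^k (A_k + (c²/12) B_k) H^{1−k}`. The `h₂`-tail is the same
statement for the transpose (`fourier2_transpose_of_contDiff`). [folklore] -/
theorem tsum_tail_norm_fourier2_le (hΦ : ContDiff ℝ ∞ (Function.uncurry Φ))
    (hΦc : HasCompactSupport (Function.uncurry Φ)) {c : ℝ} (hc : 0 < c) {k H : ℕ} (hk : 2 ≤ k)
    (hH : 1 ≤ H) :
    ∑' h : ℤ × ℤ, (if (H : ℤ) < |h.1| then ‖fourier2 Φ (h.1 / c) (h.2 / c)‖ else 0) ≤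
      2 * (c / (2 * π)) ^ k *
        ((∫ t₂, ∫ t₁, ‖iteratedDeriv k (fun s => Φ s t₂) t₁‖) +
          c ^ 2 / 12 * ∫ t₂, ∫ t₁, ‖iteratedDeriv k (fun s => iteratedDeriv 2 (Φ s) t₂) t₁‖) *
        ((H : ℝ) ^ (k - 1))⁻¹ := by
  classical
  refine Real.tsum_le_of_sum_le (fun h => by split_ifs <;> positivity) fun T => ?_
  rw [← Finset.sum_filter]
  exact sum_tail_norm_fourier2_le hΦ hΦc hc hk hH _ fun h hh => (Finset.mem_filter.mp hh).2

end Tails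

end Summit.Parity.GeneralizedHardyLittlewood.Theorems.BeyondDiagonalBeatsQuarter.OffDiagPoissonTwisted
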